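import Summits.ResolutionOfSingularities.ResolutionOfSingularities.Theorems.PurelyInseparableDim4ResConeTwoSlotTail
import Summits.ResolutionOfSingularities.ResolutionOfSingularities.Theorems.PurelyInseparableDim4ResConeCInfLetterChange
import Summits.ResolutionOfSingularities.ResolutionOfSingularities.Theorems.PurelyInseparableDim4ResConeLSectorKill
import HarnessLib
import HarnessLib.Audit.Tags

/-!
# Purely inseparable four-folds — THE TWO-SLOT TAIL IS EMPTY WITHOUT ROTATION (both sectors): assembly of K24a-γ with
# the L-sector kill (cell `res-dim4-pi`, K2(p) lane, slice B brick K24a, part γ′)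

[OURS · counted 0 · cell `res-dim4-pi` · K2(p) lane (holder res-dim4-p-12 g3); seat res-dim4-p-1 g4 over its own
`…ResConeTwoSlotTail` (T-sector), the holder's K24a-R2 `…ResConeLSectorKill` (L-sector dies in two steps, bus 03:44:04Z) and
res-dim4-p-9 g3's LC4 `exists_letter_change_of_isolated_two_slot`.]  Nothing here proves K2(p)/K2(5), `NoIsolatedTrap p p`
or resolution of singularities in dimension ≥ 4 / characteristic `p`.  AI kernel work, weaker than expert review.

* §1 `apply_eq_zero_of_kernel_iff` (two forms with the same kernel vanish at the same letters; the L-sector bookkeeping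
  `lSector_persists` / `apply_eq_zero_of_direction_of_apply_eq_zero` is the holder's, `…ResConeLSectorKill` §1).
* §2 `no_twoSlot_tail_five_of_slot_L` — the L-sector branch: at the first letter change the state two steps later is not
  isolated (holder's kill).
* §3 **`no_twoSlot_tail_five_of_noRotation`** — (T2) ∧ NO ROTATION ⇒ `False` (T-sector: `…TwoSlotTail`; L-sector: §2), and
  K27a with `hT2` discharged under `hslot` alone.

[cite: CossartJannsenSaito2020, Thm. 3.14, Thm. 9.3] bears_on: LADDER-RESOLUTION:D157-DOOR2 (res-dim4-pi · K2(p) · slice B ·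
K24a-γ′).  Supports stmt-ResolutionOfSingularities-16155 (helper).
-/

set_option linter.dupNamespace false -- mandated namespace of this single-conjunct summit

noncomputable section

namespace Summit.ResolutionOfSingularities.ResolutionOfSingularities.Theorems.PIDim4

namespace ResCone

open MvPolynomial Finset FrameChange
open Literature.AlgebraicGeometry.Resolution
open Literature.AlgebraicGeometry.Resolution.CentreBlowup
open Literature.AlgebraicGeometry.Resolution.Hauser2010
open Literature.AlgebraicGeometry.Resolution.HauserPerlega2019

variable {K : Type} [Field K]

/-! ## 1. L-sector bookkeeping -/

/-- Two linear forms cutting out the same subspace vanish at the same letters. [folklore] -/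
theorem apply_eq_zero_of_kernel_iff {V : Submodule K (Fin 4 → K)} {ℓ ℓ' : Fin 4 → K}
    (hV : ∀ w, w ∈ V ↔ dotProduct ℓ w = 0) (hV' : ∀ w, w ∈ V ↔ dotProduct ℓ' w = 0) {f : Fin 4}
    (h : ℓ' f = 0) : ℓ f = 0 := by
  have h1 : dotProduct ℓ' (Pi.single f 1) = 0 := by rw [dotProduct_single, h, zero_mul]
  have h2 := (hV _).mp ((hV' _).mpr h1)
  rwa [dotProduct_single, mul_one] at h2

/-! ## 2. The L-sector branch -/

section NoRotation

variable [CharP K 5] [DecidableEq K]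

/-- **THE L-SECTOR BRANCH OF THE TWO-SLOT TAIL** (no rotation): if at `k₁` some vertex form vanishes at a free letter, then —
the boundary being frozen `e_A + e_B + e_ν` and every translation along `f` (`…TwoSlotBoundary`) — `ℓ_k f = 0` and
`ℓ_k (j k) = 0` for all `k ≥ k₁` (holder's §1), a letter change `A → B` exists beyond `k₁ + 1` (p-9's LC4), and two steps after
it the state is not isolated (holder's `not_isIsolated_after_lSector_change_of_forms`): contradiction. [OURS]
[cite: CossartJannsenSaito2020, Thm. 3.14, Thm. 9.3] -/
theorem no_twoSlot_tail_five_of_slot_L {c : ℕ → State K} {j : ℕ → Fin 4} {b : ℕ → Fin 4 → K}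
    (hc : ∀ k, IsIsolated 5 (c k).F ∧ Step0 5 (c k) (c (k + 1))) (hw : FreeTail.IsWitnessedChain 5 c j b)
    (hr0 : ∀ e ∈ (c 0).F.support, (c 0).r ≤ e) (hfloor : ∀ k, ordZero (c k).F ≠ (5 : ℕ)) {k₀ : ℕ}
    (hshade : ∀ k, k₀ ≤ k → (c k).shade = ((3 : ℕ) : ℕ∞))
    (he3 : ∀ k, k₀ ≤ k → Module.finrank K (resVertex (c k)) = 3) {ν : Fin 4} {k₁ : ℕ} (hk₁ : k₀ ≤ k₁)
    (hidle : ∀ k, k₁ ≤ k → 1 ≤ (c k).r ν ∧ j k ≠ ν ∧ b k ν = 0)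
    (hslot : ∀ k, k₁ ≤ k → 1 ≤ (c k).r (j k))
    (hL : ∃ ℓ' : Fin 4 → K, (∀ w, w ∈ resVertex (c k₁) ↔ dotProduct ℓ' w = 0) ∧
      ∃ i, (c k₁).r i = 0 ∧ ℓ' i = 0) :
    False := by
  haveI : Fact (Nat.Prime 5) := ⟨by norm_num⟩
  -- the frame data of the power-cone stretch
  obtain ⟨ℓ, a0, lam, hpkg⟩ := chain_powerCone_package 5 hc hw hr0 hfloor (by norm_num) hshade he3
  have hV : ∀ k, k₀ ≤ k → ∀ w, w ∈ resVertex (c k) ↔ dotProduct (ℓ k) w = 0 := fun k hk => (hpkg k hk).2.1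
  have hform : ∀ k, k₀ ≤ k → resForm (c k) = C (a0 k) * (∑ i, C (ℓ k i) * X i) ^ 3 :=
    fun k hk => (hpkg k hk).2.2.1
  have hdir : ∀ k, k₀ ≤ k → ℓ k (j k) + dotProduct (ℓ k) (b k) = 0 := fun k hk => (hpkg k hk).2.2.2.1
  have hlam : ∀ k, k₀ ≤ k → lam k ≠ 0 := fun k hk => (hpkg k hk).2.2.2.2.1
  have hprop : ∀ k, k₀ ≤ k → ∀ i, i ≠ j k → ℓ (k + 1) i = lam k * ℓ k i :=
    fun k hk => (hpkg k hk).2.2.2.2.2.1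
  have hcarry : ∀ k, k₀ ≤ k → ∃ i, i ≠ j k ∧ ℓ k i ≠ 0 := fun k hk => (hpkg k hk).2.2.2.2.2.2
  -- K27a's weights: free tail (✗ FT) or weights `≤ 1` with `|r| = 3`
  have hlight : ∀ k, k₀ ≤ k → FreeTail.IsSatellite j b k → ∀ oₖ oₖ₁ : ℕ,
      ordZero (c k).F = oₖ → ordZero (c (k + 1)).F = oₖ₁ → oₖ + oₖ₁ + 3 ≤ 15 := by
    intro k hk hsat oₖ oₖ₁ hoₖ hoₖ₁
    have h := satellite_light_of_powerCone 5 hc hw hr0 hfloor (by norm_num) (by norm_num) hshade hform hdir hlam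
      hprop hcarry hk hsat hoₖ hoₖ₁
    omega
  have hfloor' : ∀ k, ordZero (c k).F ≠ 5 := fun k => by have h := hfloor k; exact_mod_cast h
  have hFT : ∀ k₂, (∀ k, k₂ ≤ k → ¬ FreeTail.IsSatellite j b k) → False := fun k₂ hfree => by
    obtain ⟨k, hk⟩ := FreeTailProof.noIsolatedFreeTailAt_self 5 K c j b k₂ hw hfree
    exact hk (hc k).1
  rcases light_weights hc hw hfloor' hshade hlight with ⟨k₂, -, hfree⟩ | hwt
  · exact hFT k₂ hfree
  -- orders `6` and the frozen boundary
  have hord : ∀ k, k₀ ≤ k → ordZero (c k).F = ((6 : ℕ) : ℕ∞) := by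
    intro k hk
    obtain ⟨o, ho, -, -, hod⟩ := chain_shade_nat 5 hc hfloor hshade hk
    rw [ho, (hwt k hk).2] at *
    have : o = 6 := by omega
    rw [this]
  have hfrozen := boundary_frozen 5 hw (k₁ := k₁) (D := 3) (fun k hk => hord k (hk₁.trans hk))
    (fun k hk => (hwt k (hk₁.trans hk)).2) (fun k hk => (hwt k (hk₁.trans hk)).1) hslot
  obtain ⟨r, hrdef⟩ : ∃ r : Fin 4 →₀ ℕ, (c k₁).r = r := ⟨_, rfl⟩
  have hrk : ∀ k, k₁ ≤ k → (c k).r = r := fun k hk => (hfrozen k hk).1.trans hrdef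
  have hbk : ∀ k, k₁ ≤ k → ∀ i, r i ≠ 0 → b k i = 0 := fun k hk i hi =>
    (hfrozen k hk).2 i (by rw [hrdef]; exact hi)
  have hw1 : ∀ i, r i ≤ 1 := fun i => by rw [← hrdef]; exact (hwt k₁ hk₁).1 i
  have hrdeg : r.degree = 3 := by rw [← hrdef]; exact (hwt k₁ hk₁).2
  -- the four letters
  have hν1 : r ν = 1 := le_antisymm (hw1 ν) (by rw [← hrdef]; exact (hidle k₁ le_rfl).1)
  obtain ⟨A, B, f, hAB, hAν, hAf, hBν, hBf, hνf, hrABν⟩ := exists_slot_letters hw1 hrdeg hν1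
  have hslots : ∀ k, k₁ ≤ k → j k = A ∨ j k = B := fun k hk =>
    chart_mem_slots hAB hAν hAf hBν hBf hνf hrABν (by rw [← hrk k hk]; exact hslot k hk) (hidle k hk).2.1
  have hjf : ∀ k, k₁ ≤ k → j k ≠ f := fun k hk => by
    rcases hslots k hk with h | h
    · rw [h]; exact hAf
    · rw [h]; exact hBf
  have hbsingle : ∀ k, k₁ ≤ k → b k = Pi.single f (b k f) := fun k hk =>
    translation_eq_single hAB hAν hAf hBν hBf hνf hrABν (hbk k hk)
  -- the L-sector at `k₁`, and for ever
  obtain ⟨ℓ', hV', i, hri, hℓ'i⟩ := hL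
  have hif : i = f := by
    rw [hrdef, hrABν] at hri
    rcases letters_exhaust hAB hAν hAf hBν hBf hνf i with h | h | h | h
    · subst h; simp [hAB, hAν] at hri
    · subst h; simp [hAB.symm, hBν] at hri
    · subst h; simp [hAν.symm, hBν.symm] at hri
    · exact h
  subst hif
  have hℓf0 : ℓ k₁ i = 0 := apply_eq_zero_of_kernel_iff (hV k₁ hk₁) hV' hℓ'i
  have hℓf : ∀ k, k₁ ≤ k → ℓ k i = 0 := lSector_persists hk₁ hprop hjf hℓf0
  have hℓj : ∀ k, k₁ ≤ k → ℓ k (j k) = 0 := fun k hk =>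
    apply_eq_zero_of_direction_of_apply_eq_zero (hℓf k hk) (by rw [← hbsingle k hk]; exact hdir k (hk₁.trans hk))
  -- a letter change `A → B` beyond `k₁ + 1`
  obtain ⟨k, hk, hjA, hjB⟩ := exists_letter_change_of_isolated_two_slot 5 hw (fun k => (hc k).1) hslots (k₁ + 1)
  have hk₁k : k₁ ≤ k := by omega
  have hdivk := IsolatedBand.isolated_chain_forall_le hc hr0
  have hs₁ : c (k + 1) = CentreBlowup.step 5 Finset.univ A (Pi.single i (b k i)) (c k) := by
    rw [(hw k).2.2.2.2, hjA, ← hbsingle k hk₁k]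
  have hs₂ : c (k + 2) = CentreBlowup.step 5 Finset.univ B (Pi.single i (b (k + 1) i)) (c (k + 1)) := by
    rw [show k + 2 = (k + 1) + 1 by omega, (hw (k + 1)).2.2.2.2, hjB, ← hbsingle (k + 1) (by omega)]
  have hℓA : ℓ k A = 0 := by rw [← hjA]; exact hℓj k hk₁k
  have hℓB : ℓ (k + 1) B = 0 := by rw [← hjB]; exact hℓj (k + 1) (by omega)
  refine not_isIsolated_after_lSector_change_of_forms hAB hAν hAf hBν hBf hνf (c k) (b k i) (b (k + 1) i)
    (by rw [hord k (hk₁.trans hk₁k)]; rfl) (hdivk k) ((hrk k hk₁k).trans hrABν) (hform k (hk₁.trans hk₁k)) hℓA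
    (hℓf k hk₁k) hs₁ (by rw [hord (k + 1) (by omega)]; rfl) (hdivk (k + 1)) ((hrk (k + 1) (by omega)).trans hrABν)
    (hform (k + 1) (by omega)) hℓB (hℓf (k + 1) (by omega)) hs₂ (hc (k + 2)).1

/-! ## 3. The two-slot tail without rotation -/

/-- **NO TWO-SLOT TAIL WITHOUT ROTATION** (K24a-γ′): the (T2) configuration of the light `d = 3` tail at `p = 5` — idle
boundary letter `ν`, the other boundary letters stretch-born — with SLOT STEPS ONLY from `k₁` on (`1 ≤ r_k (j k)`: no rotation
step) is contradictory on a witnessed isolated above-floor `Step0 5` chain of shade `3`, `e_G = 3`: T-sector by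
`no_twoSlot_tail_five_of_slot` (idea-4's two-slot game), L-sector by `no_twoSlot_tail_five_of_slot_L` (the holder's two-step
kill).  The one remaining named hypothesis of K24a is `hslot` (the rotation steps, β4-F). [OURS]
[cite: CossartJannsenSaito2020, Thm. 3.14, Thm. 9.3] -/
theorem no_twoSlot_tail_five_of_noRotation {c : ℕ → State K} {j : ℕ → Fin 4} {b : ℕ → Fin 4 → K}
    (hc : ∀ k, IsIsolated 5 (c k).F ∧ Step0 5 (c k) (c (k + 1))) (hw : FreeTail.IsWitnessedChain 5 c j b)
    (hr0 : ∀ e ∈ (c 0).F.support, (c 0).r ≤ e) (hfloor : ∀ k, ordZero (c k).F ≠ (5 : ℕ)) {k₀ : ℕ}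
    (hshade : ∀ k, k₀ ≤ k → (c k).shade = ((3 : ℕ) : ℕ∞))
    (he3 : ∀ k, k₀ ≤ k → Module.finrank K (resVertex (c k)) = 3) {ν : Fin 4} {k₁ : ℕ} (hk₁ : k₀ ≤ k₁)
    (hidle : ∀ k, k₁ ≤ k → 1 ≤ (c k).r ν ∧ j k ≠ ν ∧ b k ν = 0)
    (hborn : ∀ k, k₁ ≤ k → ∀ i, i ≠ ν → 1 ≤ (c k).r i →
      ∃ t, k₀ ≤ t ∧ t < k ∧ j t = i ∧ ∀ m, t < m → m < k → j m ≠ i ∧ b m i = 0)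
    (hslot : ∀ k, k₁ ≤ k → 1 ≤ (c k).r (j k)) : False := by
  by_cases hT : ∀ ℓ : Fin 4 → K, (∀ w, w ∈ resVertex (c k₁) ↔ dotProduct ℓ w = 0) → ∀ i, (c k₁).r i = 0 → ℓ i ≠ 0
  · exact no_twoSlot_tail_five_of_slot hc hw hr0 hfloor hshade he3 hk₁ hidle hborn hslot hT
  · push Not at hT
    exact no_twoSlot_tail_five_of_slot_L hc hw hr0 hfloor hshade he3 hk₁ hidle hslot hT

/-- **THE LIGHT `d = 3` TAIL AT `p = 5` IS EMPTY GIVEN NO ROTATION** (K27a `no_light_powerCone_tail_three_five_of` with `hT2`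
discharged by `no_twoSlot_tail_five_of_noRotation`): a witnessed isolated above-floor `Step0 5` chain with `x^{r₀} ∣ F₀` cannot have
shade `3` and `e_G = 3` from `k₀` on if from `k₀` on every chart letter is a boundary letter. [OURS · conditional on the one
named residual hypothesis `hslot` (β4-F)] [cite: CossartJannsenSaito2020, Thm. 3.10(4), Thm. 3.14, Thm. 9.3] -/
theorem no_light_powerCone_tail_three_five_of_noRotation {c : ℕ → State K} {j : ℕ → Fin 4} {b : ℕ → Fin 4 → K}
    (hc : ∀ k, IsIsolated 5 (c k).F ∧ Step0 5 (c k) (c (k + 1))) (hw : FreeTail.IsWitnessedChain 5 c j b)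
    (hr0 : ∀ e ∈ (c 0).F.support, (c 0).r ≤ e) (hfloor : ∀ k, ordZero (c k).F ≠ (5 : ℕ)) {k₀ : ℕ}
    (hshade : ∀ k, k₀ ≤ k → (c k).shade = ((3 : ℕ) : ℕ∞))
    (he3 : ∀ k, k₀ ≤ k → Module.finrank K (resVertex (c k)) = 3)
    (hslot : ∀ k, k₀ ≤ k → 1 ≤ (c k).r (j k)) : False :=
  no_light_powerCone_tail_three_five_of hc hw hr0 hfloor hshade he3 fun _ _ hk₁ hidle hborn =>
    no_twoSlot_tail_five_of_noRotation hc hw hr0 hfloor hshade he3 hk₁ hidle hborn fun k hk => hslot k (hk₁.trans hk)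

end NoRotation

end ResCone

end Summit.ResolutionOfSingularities.ResolutionOfSingularities.Theorems.PIDim4

end
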